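import Summits.RiemannHypothesis.RiemannHypothesis.Theorems.TiltedLandingLaw421R3SinkTemplate

/-!
# «SinkMirror» v1 — MIRROR COVARIANCE of 102's sink template: certificates for children LEFT of the axis from certificates for children RIGHT of it
(C1 desk, rh-idea-5 g39; files-only; SUPPORT, K only)

ONE import: TREE #1255 «SinkTemplate» (102).  Namespace `RhW08.SinkMirror`; nothing of 102 re-declared.  (K) only, asserts no law.
The reflection `z ↦ 2·xv − z̄` in the axis `Re z = xv` fixes the axis reading points, sends the pair kernel to `K_{u'}(z') = −conj (K_u(z))`
(`Re` flips, `Im` is kept), and therefore maps a cut `(p, e, y)` to the cut `(p, −ē, y)` (a real-part cut `e = −1` becomes `e = +1`): with that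
MIRRORED FAMILY the kernel numerator, `c`, the maximal strip, kernel domination (K)/(K∂), admissibility, the certified level at the tracked read value
`G = −mult·K_v(w)` (`v` on the axis) and the modulus `‖K_v(w)‖` are all INVARIANT.  Consequence ★`certificatesExistSig_of_right`: 102's
`CertificatesExistSig lam` follows from its restriction `CertificatesExistRightSig lam` to children with `xv ≤ Re w` — so realTwoPoint-type corner
conjectures may (and, by the decided instance `RhW08.SinkMirrorNeg.not_cornerDominanceSig`, must) be stated for `xv ≤ Re w` only, at no cost for the
open sink item.
LEVEL: SUPPORT (K).  No `sorry`.  Nothing here bears on the truth of RH; RH is not proved; ⟨33346⟩/⟨33347⟩ OPEN; `CertificatesExistSig` /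
`CertificatesExistRightSig` OPEN (defs, not asserted); checked ≠ keyed ≠ landed ≠ proved.
-/

noncomputable section

open Complex
open scoped ComplexConjugate
open RhW08.SinkTemplate

namespace RhW08.SinkMirror

variable {κ : Type} [Fintype κ]

/-! ## §1 The reflection in the axis and the kernels -/

/-- reflection in the axis `Re z = xv`: `z ↦ 2·xv − z̄` (keeps `Im z`, sends `Re z − xv` to its negative). -/
def mirrorPt (xv : ℝ) (z : ℂ) : ℂ := ((2 * xv : ℝ) : ℂ) - conj z

/-- the reflection is an involution. -/
theorem mirrorPt_mirrorPt (xv : ℝ) (z : ℂ) : mirrorPt xv (mirrorPt xv z) = z := by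
  unfold mirrorPt
  simp only [map_sub, Complex.conj_ofReal, Complex.conj_conj, sub_sub_cancel]

/-- real part of the reflected point. -/
theorem mirrorPt_re (xv : ℝ) (z : ℂ) : (mirrorPt xv z).re = 2 * xv - z.re := by
  simp [mirrorPt]

/-- the reflection keeps the imaginary part. -/
theorem mirrorPt_im (xv : ℝ) (z : ℂ) : (mirrorPt xv z).im = z.im := by
  simp [mirrorPt]

/-- points ON the axis are fixed. -/
theorem mirrorPt_of_re_eq (xv : ℝ) (z : ℂ) (hz : z.re = xv) : mirrorPt xv z = z := by
  apply Complex.ext <;> simp [mirrorPt, hz]; ring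

/-- `|Re z' − xv| = |Re z − xv|`. -/
theorem abs_mirrorPt_re_sub (xv : ℝ) (z : ℂ) : |(mirrorPt xv z).re - xv| = |z.re - xv| := by
  rw [mirrorPt_re, show 2 * xv - z.re - xv = -(z.re - xv) by ring, abs_neg]

/-- THE KERNEL UNDER REFLECTION: `K_{u'}(z') = −conj (K_u(z))`. -/
theorem farPairK_mirror (xv : ℝ) (u z : ℂ) : farPairK (mirrorPt xv u) (mirrorPt xv z) = -conj (farPairK u z) := by
  have h1 : mirrorPt xv z - mirrorPt xv u = -conj (z - u) := by
    unfold mirrorPt; simp only [map_sub]; ring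
  have h2 : mirrorPt xv z - conj (mirrorPt xv u) = -conj (z - conj u) := by
    unfold mirrorPt; simp only [map_sub, Complex.conj_ofReal, Complex.conj_conj]; ring
  unfold farPairK
  rw [h1, h2, div_neg, div_neg, map_add, neg_add, map_div₀, map_div₀, map_one]

/-- `c` is reflection-invariant. -/
theorem farPairC_mirror (xv : ℝ) (w u : ℂ) : farPairC (mirrorPt xv w) (mirrorPt xv u) = farPairC w u := by
  unfold farPairC
  rw [farPairK_mirror, Complex.neg_im, Complex.conj_im, neg_neg]

/-- `‖K_{v}(w')‖ = ‖K_v(w)‖` for `v` on the axis. -/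
theorem norm_farPairK_mirror (xv : ℝ) (v w : ℂ) (hv : v.re = xv) : ‖farPairK v (mirrorPt xv w)‖ = ‖farPairK v w‖ := by
  conv_lhs => rw [← mirrorPt_of_re_eq xv v hv]
  rw [farPairK_mirror, norm_neg, Complex.norm_conj]

/-! ## §2 The mirrored cut family -/

/-- the MIRRORED CUT: same (axis) reading point reflected, direction `−ē`, same weight (`e = −1 ↦ e = +1`). -/
def mirrorCut (xv : ℝ) (c : Cut) : Cut := ⟨mirrorPt xv c.p, -conj c.e, c.y⟩

/-- the mirrored family. -/
def mirrorCuts (xv : ℝ) (cs : κ → Cut) : κ → Cut := fun k => mirrorCut xv (cs k)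

/-- the kernel numerator is reflection-invariant (family, child and far zero all reflected). -/
theorem cutNumer_mirror (xv : ℝ) (cs : κ → Cut) (w u : ℂ) :
    cutNumer (mirrorCuts xv cs) (mirrorPt xv w) (mirrorPt xv u) = cutNumer cs w u := by
  unfold cutNumer mirrorCuts mirrorCut
  refine Finset.sum_congr rfl fun k _ => ?_
  simp only
  rw [farPairK_mirror, farPairK_mirror]
  have hk : conj (-conj (cs k).e) * (-conj (farPairK u w) - -conj (farPairK u (cs k).p)) =
      conj (conj (cs k).e * (farPairK u w - farPairK u (cs k).p)) := by
    simp only [map_neg, map_mul, map_sub, Complex.conj_conj]; ring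
  rw [hk, Complex.conj_re]

/-- admissibility is reflection-invariant. -/
theorem cutsAdmissible_mirror (xv : ℝ) (cs : κ → Cut) (h : CutsAdmissible xv cs) : CutsAdmissible xv (mirrorCuts xv cs) := by
  refine ⟨fun k => ⟨(h.1 k).1, ?_, ?_⟩, h.2⟩
  · show ‖-conj (cs k).e‖ = 1
    rw [norm_neg, Complex.norm_conj]; exact (h.1 k).2.1
  · show (mirrorPt xv (cs k).p).re = xv
    rw [mirrorPt_re, (h.1 k).2.2]; ring

/-- the reading points of the mirrored family are the same axis points. -/
theorem mirrorCuts_p (xv : ℝ) (cs : κ → Cut) (h : CutsAdmissible xv cs) (k : κ) : (mirrorCuts xv cs k).p = (cs k).p :=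
  mirrorPt_of_re_eq xv _ (h.1 k).2.2

/-- the maximal strip is reflection-invariant. -/
theorem maxStrip_mirror_iff (xv R : ℝ) (u : ℂ) : MaxStrip xv R (mirrorPt xv u) ↔ MaxStrip xv R u := by
  unfold MaxStrip
  rw [abs_mirrorPt_re_sub, mirrorPt_im]

/-- its boundary likewise. -/
theorem maxStripBdry_mirror_iff (xv R : ℝ) (u : ℂ) : MaxStripBdry xv R (mirrorPt xv u) ↔ MaxStripBdry xv R u := by
  unfold MaxStripBdry
  rw [abs_mirrorPt_re_sub, mirrorPt_im]

/-- (K) transfers to the mirrored family at the reflected child. -/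
theorem kernelDom_mirror (xv R : ℝ) (cs : κ → Cut) (w : ℂ) (σ : ℝ) (h : KernelDom xv R cs w σ) :
    KernelDom xv R (mirrorCuts xv cs) (mirrorPt xv w) σ := by
  intro u hu
  have hK := h (mirrorPt xv u) ((maxStrip_mirror_iff xv R u).2 hu)
  rw [← mirrorPt_mirrorPt xv u, cutNumer_mirror, farPairC_mirror]
  exact hK

/-- (K∂) transfers likewise. -/
theorem kernelDomBdry_mirror (xv R : ℝ) (cs : κ → Cut) (w : ℂ) (σ : ℝ) (h : KernelDomBdry xv R cs w σ) :
    KernelDomBdry xv R (mirrorCuts xv cs) (mirrorPt xv w) σ := by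
  intro u hu
  have hK := h (mirrorPt xv u) ((maxStripBdry_mirror_iff xv R u).2 hu)
  rw [← mirrorPt_mirrorPt xv u, cutNumer_mirror, farPairC_mirror]
  exact hK

/-- the certified level is reflection-invariant: `L_cert(mirrored family, −conj G, σ) = L_cert(family, G, σ)`. -/
theorem lcert_mirror (xv : ℝ) (cs : κ → Cut) (G : ℂ) (σ : ℝ) : Lcert (mirrorCuts xv cs) (-conj G) σ = Lcert cs G σ := by
  unfold Lcert mirrorCuts mirrorCut
  congr 1
  · refine Finset.sum_congr rfl fun k _ => ?_
    simp only [map_neg, Complex.conj_conj, neg_mul_neg]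
    rw [← Complex.conj_re ((cs k).e * conj G), map_mul, Complex.conj_conj]
  · rw [Complex.neg_im, Complex.conj_im, neg_neg]

/-- the TRACKED read value reflects to `−conj`: `−mult·K_v(w') = −conj (−mult·K_v(w))` for `v` on the axis. -/
theorem trackedRead_mirror (xv : ℝ) (v w : ℂ) (hv : v.re = xv) (mult : ℕ) :
    -((mult : ℂ) * farPairK v (mirrorPt xv w)) = -conj (-((mult : ℂ) * farPairK v w)) := by
  conv_lhs => rw [← mirrorPt_of_re_eq xv v hv]
  rw [farPairK_mirror, map_neg, map_mul, Complex.conj_natCast]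
  ring

/-- the datum alternative (D) transfers to the mirrored family at the reflected child. -/
theorem datumAlt_mirror (xv lam s : ℝ) (cs : κ → Cut) (v w : ℂ) (hv : v.re = xv) (mult : ℕ) (σ : ℝ)
    (h : DatumAlt lam s ‖farPairK v w‖ cs (-((mult : ℂ) * farPairK v w)) σ) :
    DatumAlt lam s ‖farPairK v (mirrorPt xv w)‖ (mirrorCuts xv cs) (-((mult : ℂ) * farPairK v (mirrorPt xv w))) σ := by
  unfold DatumAlt at h ⊢
  rw [norm_farPairK_mirror xv v w hv, trackedRead_mirror xv v w hv, lcert_mirror]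
  exact h

/-! ## §3 Certificates for left children from certificates for right children -/

/-- 102's `CertificatesExistSig lam` RESTRICTED to children right of (or on) the axis: the extra binder `xv ≤ w.re`. -/
def CertificatesExistRightSig (lam : ℝ) : Prop :=
  ∀ (xv R s h : ℝ) (v w : ℂ) (mult : ℕ),
    0 < s → 2 * s ≤ h → 3 * h < R → v.re = xv → 0 < v.im → v.im ≤ h →
    0 < w.im → w.im < v.im → v.im - s / 4 < w.im → (w.re - xv) ^ 2 + w.im ^ 2 ≤ v.im ^ 2 → 1 ≤ mult → xv ≤ w.re →
    ∃ (n : ℕ) (cs : Fin n → Cut) (σ : ℝ), CutsAdmissible xv cs ∧ (∀ k, (cs k).p = ⟨xv, w.im⟩ ∨ (cs k).p = ⟨xv, h⟩) ∧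
      KernelDom xv R cs w σ ∧
      DatumAlt lam s ‖farPairK v w‖ cs (-((mult : ℂ) * farPairK v w)) σ

/-- ★ (K) certificates for ALL children from certificates for right children, by reflection. -/
theorem certificatesExistSig_of_right (lam : ℝ) (hR : CertificatesExistRightSig lam) : CertificatesExistSig lam := by
  intro xv R s h v w mult hs hsh h3 hv hY hYh ht htY hdrop hnest hmult
  rcases le_or_gt xv w.re with hright | hleft
  · exact hR xv R s h v w mult hs hsh h3 hv hY hYh ht htY hdrop hnest hmult hright
  · -- reflect the child, certify on the right, reflect the certificate back
    set w' := mirrorPt xv w with hw'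
    have hw're : xv ≤ w'.re := by rw [hw', mirrorPt_re]; linarith
    have hnest' : (w'.re - xv) ^ 2 + w'.im ^ 2 ≤ v.im ^ 2 := by
      rw [hw', mirrorPt_re, mirrorPt_im]; nlinarith [hnest]
    obtain ⟨n, cs, σ, hadm, hpts, hK, hD⟩ :=
      hR xv R s h v w' mult hs hsh h3 hv hY hYh (by rw [hw', mirrorPt_im]; exact ht) (by rw [hw', mirrorPt_im]; exact htY)
        (by rw [hw', mirrorPt_im]; exact hdrop) hnest' hmult hw're
    have hww : mirrorPt xv w' = w := by rw [hw', mirrorPt_mirrorPt]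
    refine ⟨n, mirrorCuts xv cs, σ, cutsAdmissible_mirror xv cs hadm, fun k => ?_, ?_, ?_⟩
    · rw [mirrorCuts_p xv cs hadm k, show w.im = w'.im by rw [hw', mirrorPt_im]]; exact hpts k
    · have := kernelDom_mirror xv R cs w' σ hK; rwa [hww] at this
    · have := datumAlt_mirror xv lam s cs v w' hv mult σ hD; rwa [hww] at this

end RhW08.SinkMirror

end
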